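import Summits.RiemannHypothesis.RiemannHypothesis.Theorems.GroundBartaEvenWinsBeyondArchDeflationPSDScaled
import HarnessLib

/-!
# RiemannHypothesis / GroundBarta — rung 4 (`EvenWinsBeyondArch`, stmt-RiemannHypothesis-18807 / 18085):
# the deflated Temple L-side, A-layer VI — the sigma-criterion matrix is PSD from entrywise bounds on `A`

Helper file (`--supports`), RH-free, no named facts.  Prover A, speedrun unit `sr-gb-rung-a` (gen 2).

The hypothesis `hN` of `dt_weilOddGroundEnergy_ge_of_deflCert_sigma` (prover B) asks for
`∀ α, 0 ≤ Σ α_i α_j N_ij`, `N_ij = (β − λ)(A_ij − λ G_ij) − δ_ij τ θ_i`, where `A_ij = P₂(v_i,v_j) + 𝓔₂(v_i,v_j) − M_c G_ij`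
is only known through two-sided rational bounds `Alo_ij ≤ A_ij ≤ Ahi_ij` (A-layer certificates) and `G_ij` is an exact
rational.  `dt_hN_of_bounds` reduces it to the scaled kernel certificate `dt_psd_of_scaledCertificate`: with scales
`s_i > 0` the interval of `s_i s_j N_ij` is `[(β−λ)(Alo − λG) − d, (β−λ)(Ahi − λG) − d]·s_i s_j` (`β > λ`), and the check
`nCheck` verifies that it lies inside `[P_ij − E_ij, P_ij + E_ij]` for the certificate's rational `P`, `E`.

References: S. M. Rump, *Verification of positive definiteness*, BIT 46 (2006) 433–452, §2 [Rump2006PosDef].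
-/

set_option linter.dupNamespace false

noncomputable section

open Finset
open scoped BigOperators

namespace Summit.RiemannHypothesis.RiemannHypothesis.Theorems.EvenWinsBeyondArch

/-- The sigma-criterion matrix entry as a function of `A_ij`: `N(a) = (β − λ)(a − λ g) − d`. [folklore] -/
def nEntry (β lam g d a : ℚ) : ℚ := (β - lam) * (a - lam * g) - d

/-- The entrywise containment check: the image of `[Alo, Ahi]` under the (increasing, for `β > λ`) affine map
`a ↦ s_i s_j N(a)` lies in `[P − E, P + E]`. [folklore] -/
def nCheck {k : ℕ} (β lam τ : ℚ) (θ s : Fin k → ℚ) (Alo Ahi G P E : Fin k → Fin k → ℚ) : Bool :=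
  decide (lam < β) && decide (∀ i, 0 < s i) &&
    decide (∀ i j, P i j - E i j ≤ s i * s j * nEntry β lam (G i j) (if i = j then τ * θ i else 0) (Alo i j) ∧
      s i * s j * nEntry β lam (G i j) (if i = j then τ * θ i else 0) (Ahi i j) ≤ P i j + E i j)

/-- **`hN` from entrywise bounds on `A` and the scaled kernel certificate.** [cite: Rump2006PosDef, §2] -/
theorem dt_hN_of_bounds {k m : ℕ} (A : Fin k → Fin k → ℝ) (Alo Ahi G : Fin k → Fin k → ℚ)
    (hA : ∀ i j, (Alo i j : ℝ) ≤ A i j ∧ A i j ≤ (Ahi i j : ℝ)) (Gr : Fin k → Fin k → ℝ) (hG : ∀ i j, Gr i j = G i j)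
    (β lam τ : ℚ) (θ s : Fin k → ℚ) (P E : Fin k → Fin k → ℚ) (D : Fin m → ℚ) (L : Fin m → Fin k → ℚ) (δ : ℚ)
    (hchk : nCheck β lam τ θ s Alo Ahi G P E = true) (hrow : ∀ i, ∑ j, E i j ≤ δ) (hcol : ∀ j, ∑ i, E i j ≤ δ)
    (hD : ∀ r, 0 ≤ D r) (hP : ∀ i j, P i j = δ * (if i = j then 1 else 0) + ∑ r, D r * L r i * L r j)
    (α : Fin k → ℝ) :
    0 ≤ ∑ i, ∑ j, α i * α j *
      (((β : ℝ) - lam) * (A i j - (lam : ℝ) * Gr i j) - if i = j then (τ : ℝ) * θ i else 0) := by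
  unfold nCheck at hchk
  simp only [Bool.and_eq_true, decide_eq_true_eq] at hchk
  obtain ⟨⟨hβ, hs⟩, hPE⟩ := hchk
  refine dt_psd_of_scaledCertificate _ s hs P E D L δ (fun i j ↦ ?_) hrow hcol hD hP α
  obtain ⟨h1, h2⟩ := hPE i j
  obtain ⟨ha1, ha2⟩ := hA i j
  have hβ' : (0 : ℝ) < (β : ℝ) - lam := by
    have : (lam : ℝ) < β := by exact_mod_cast hβ
    linarith
  have hss : (0 : ℝ) < (s i : ℝ) * s j := by
    have := hs i; have := hs j; positivity
  rw [hG i j]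
  -- the affine map is increasing in `a`
  have lo : (s i : ℝ) * s j * (((β : ℝ) - lam) * ((Alo i j : ℝ) - lam * G i j) - if i = j then (τ : ℝ) * θ i else 0) ≤
      (s i : ℝ) * s j * (((β : ℝ) - lam) * (A i j - lam * G i j) - if i = j then (τ : ℝ) * θ i else 0) := by
    apply mul_le_mul_of_nonneg_left _ hss.le
    have := mul_le_mul_of_nonneg_left (sub_le_sub_right ha1 ((lam : ℝ) * G i j)) hβ'.le
    linarith
  have hi : (s i : ℝ) * s j * (((β : ℝ) - lam) * (A i j - lam * G i j) - if i = j then (τ : ℝ) * θ i else 0) ≤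
      (s i : ℝ) * s j * (((β : ℝ) - lam) * ((Ahi i j : ℝ) - lam * G i j) - if i = j then (τ : ℝ) * θ i else 0) := by
    apply mul_le_mul_of_nonneg_left _ hss.le
    have := mul_le_mul_of_nonneg_left (sub_le_sub_right ha2 ((lam : ℝ) * G i j)) hβ'.le
    linarith
  have h1r : ((P i j : ℚ) : ℝ) - E i j ≤
      (s i : ℝ) * s j * (((β : ℝ) - lam) * ((Alo i j : ℝ) - lam * G i j) - if i = j then (τ : ℝ) * θ i else 0) := by
    have := h1
    unfold nEntry at this
    split_ifs at this ⊢ with hij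
    · exact_mod_cast this
    · exact_mod_cast this
  have h2r : (s i : ℝ) * s j * (((β : ℝ) - lam) * ((Ahi i j : ℝ) - lam * G i j) - if i = j then (τ : ℝ) * θ i else 0) ≤
      ((P i j : ℚ) : ℝ) + E i j := by
    have := h2
    unfold nEntry at this
    split_ifs at this ⊢ with hij
    · exact_mod_cast this
    · exact_mod_cast this
  rw [abs_le]
  constructor <;> linarith

/-! ## Version with an interval for `β` (the bridge's `β = β₂₃ − (log 2)/2` is irrational) -/

/-- Corner containment for the product of the intervals `[βlo − λ, βhi − λ] · [Alo − λg, Ahi − λg]` (the first positive),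
shifted by `−d` and scaled by `s_i s_j`, inside `[P − E, P + E]`. [folklore] -/
def nCheck₂ {k : ℕ} (βlo βhi lam τ : ℚ) (θ s : Fin k → ℚ) (Alo Ahi G P E : Fin k → Fin k → ℚ) : Bool :=
  decide (lam < βlo) && decide (βlo ≤ βhi) && decide (∀ i, 0 < s i) && decide (∀ i j, Alo i j ≤ Ahi i j) &&
    decide (∀ i j, ∀ β ∈ [βlo, βhi], ∀ a ∈ [Alo i j, Ahi i j],  -- the four corners (list membership)
      P i j - E i j ≤ s i * s j * nEntry β lam (G i j) (if i = j then τ * θ i else 0) a ∧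
        s i * s j * nEntry β lam (G i j) (if i = j then τ * θ i else 0) a ≤ P i j + E i j)

/-- A bilinear expression `y · x` with `y ∈ [ylo, yhi]`, `ylo > 0`… more precisely `y ≥ ylo > ?` is not needed: for
`y ∈ [ylo, yhi]` and `x ∈ [xlo, xhi]`, `y x` lies between the min and max of the four corner products. We use the convex
form: `y x` is a convex combination of corner values in each variable separately. [folklore] -/
theorem mul_mem_corners {y ylo yhi x xlo xhi m M : ℝ} (hy1 : ylo ≤ y) (hy2 : y ≤ yhi) (hx1 : xlo ≤ x) (hx2 : x ≤ xhi)
    (h1 : m ≤ ylo * xlo) (h2 : m ≤ ylo * xhi) (h3 : m ≤ yhi * xlo) (h4 : m ≤ yhi * xhi)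
    (h5 : ylo * xlo ≤ M) (h6 : ylo * xhi ≤ M) (h7 : yhi * xlo ≤ M) (h8 : yhi * xhi ≤ M) :
    m ≤ y * x ∧ y * x ≤ M := by
  -- write y = ylo + u (yhi - ylo), x = xlo + w (xhi - xlo) with u, w ∈ [0,1]; the product is affine in each
  have key : ∀ (x : ℝ), xlo ≤ x → x ≤ xhi → ∀ (mm MM : ℝ), mm ≤ ylo * x → mm ≤ yhi * x → ylo * x ≤ MM → yhi * x ≤ MM →
      mm ≤ y * x ∧ y * x ≤ MM := by
    intro x _ _ mm MM a1 a2 b1 b2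
    rcases le_total 0 x with hx | hx
    · constructor
      · nlinarith [mul_le_mul_of_nonneg_right hy1 hx, mul_le_mul_of_nonneg_right hy2 hx]
      · nlinarith [mul_le_mul_of_nonneg_right hy1 hx, mul_le_mul_of_nonneg_right hy2 hx]
    · constructor
      · nlinarith [mul_le_mul_of_nonpos_right hy1 hx, mul_le_mul_of_nonpos_right hy2 hx]
      · nlinarith [mul_le_mul_of_nonpos_right hy1 hx, mul_le_mul_of_nonpos_right hy2 hx]
  -- first bound ylo*x and yhi*x between corner values (affine in x)
  have hlo : ∀ (c : ℝ), (m ≤ c * xlo) → (m ≤ c * xhi) → m ≤ c * x := by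
    intro c c1 c2
    rcases le_total 0 c with hc | hc
    · rcases le_total (c * xlo) (c * xhi) with h | h
      · exact c1.trans (mul_le_mul_of_nonneg_left hx1 hc)
      · exact c2.trans (by nlinarith [mul_le_mul_of_nonneg_left hx2 hc])
    · exact c2.trans (mul_le_mul_of_nonpos_left hx2 hc)
  have hhi : ∀ (c : ℝ), (c * xlo ≤ M) → (c * xhi ≤ M) → c * x ≤ M := by
    intro c c1 c2
    rcases le_total 0 c with hc | hc
    · exact (mul_le_mul_of_nonneg_left hx2 hc).trans c2
    · exact (mul_le_mul_of_nonpos_left hx1 hc).trans c1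
  exact key x hx1 hx2 m M (hlo ylo h1 h2) (hlo yhi h3 h4) (hhi ylo h5 h6) (hhi yhi h7 h8)

/-- **`hN` from entrywise bounds on `A`, an interval `[βlo, βhi] ∋ β`, exact `G`, and the scaled kernel certificate.**
[cite: Rump2006PosDef, §2] -/
theorem dt_hN_of_bounds₂ {k m : ℕ} (A : Fin k → Fin k → ℝ) (Alo Ahi G : Fin k → Fin k → ℚ)
    (hA : ∀ i j, (Alo i j : ℝ) ≤ A i j ∧ A i j ≤ (Ahi i j : ℝ)) (Gr : Fin k → Fin k → ℝ) (hG : ∀ i j, Gr i j = G i j)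
    {β : ℝ} (βlo βhi : ℚ) (hβ : (βlo : ℝ) ≤ β ∧ β ≤ (βhi : ℝ))
    (lam τ : ℚ) (θ s : Fin k → ℚ) (P E : Fin k → Fin k → ℚ) (D : Fin m → ℚ) (L : Fin m → Fin k → ℚ) (δ : ℚ)
    (hchk : nCheck₂ βlo βhi lam τ θ s Alo Ahi G P E = true) (hrow : ∀ i, ∑ j, E i j ≤ δ) (hcol : ∀ j, ∑ i, E i j ≤ δ)
    (hD : ∀ r, 0 ≤ D r) (hP : ∀ i j, P i j = δ * (if i = j then 1 else 0) + ∑ r, D r * L r i * L r j)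
    (α : Fin k → ℝ) :
    0 ≤ ∑ i, ∑ j, α i * α j *
      ((β - lam) * (A i j - (lam : ℝ) * Gr i j) - if i = j then (τ : ℝ) * θ i else 0) := by
  unfold nCheck₂ at hchk
  simp only [Bool.and_eq_true, decide_eq_true_eq] at hchk
  obtain ⟨⟨⟨⟨hβl, hββ⟩, hs⟩, hAA⟩, hPE⟩ := hchk
  refine dt_psd_of_scaledCertificate _ s hs P E D L δ (fun i j ↦ ?_) hrow hcol hD hP α
  obtain ⟨ha1, ha2⟩ := hA i j
  have hss : (0 : ℝ) < (s i : ℝ) * s j := by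
    have := hs i; have := hs j; positivity
  rw [hG i j]
  -- the four corners, from the check at β ∈ {βlo, βhi}, a ∈ {Alo, Ahi}
  have c := fun (β' : ℚ) (hβ' : β' ∈ [βlo, βhi]) (a : ℚ) (ha : a ∈ [Alo i j, Ahi i j]) ↦ hPE i j β' hβ' a ha
  have mlo : βlo ∈ [βlo, βhi] := by simp
  have mhi : βhi ∈ [βlo, βhi] := by simp
  have alo : Alo i j ∈ [Alo i j, Ahi i j] := by simp
  have ahi : Ahi i j ∈ [Alo i j, Ahi i j] := by simp
  obtain ⟨c1, c5⟩ := c βlo mlo (Alo i j) alo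
  obtain ⟨c2, c6⟩ := c βlo mlo (Ahi i j) ahi
  obtain ⟨c3, c7⟩ := c βhi mhi (Alo i j) alo
  obtain ⟨c4, c8⟩ := c βhi mhi (Ahi i j) ahi
  unfold nEntry at c1 c2 c3 c4 c5 c6 c7 c8
  have c1r := (Rat.cast_le (K := ℝ)).2 c1
  have c2r := (Rat.cast_le (K := ℝ)).2 c2
  have c3r := (Rat.cast_le (K := ℝ)).2 c3
  have c4r := (Rat.cast_le (K := ℝ)).2 c4
  have c5r := (Rat.cast_le (K := ℝ)).2 c5
  have c6r := (Rat.cast_le (K := ℝ)).2 c6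
  have c7r := (Rat.cast_le (K := ℝ)).2 c7
  have c8r := (Rat.cast_le (K := ℝ)).2 c8
  push_cast at c1r c2r c3r c4r c5r c6r c7r c8r
  -- real forms
  set d : ℚ := if i = j then τ * θ i else 0 with hd
  have hdR : (if i = j then (τ : ℝ) * θ i else 0) = (d : ℝ) := by
    rw [hd]; split_ifs <;> push_cast <;> rfl
  rw [hdR]
  -- target: |s_i s_j ((β - lam)(A - lam G) - d) - P| ≤ E; write as s_i s_j (β - lam)(A - lam G) ∈ corners
  have key := mul_mem_corners (y := β - lam) (ylo := (βlo : ℝ) - lam) (yhi := (βhi : ℝ) - lam)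
    (x := A i j - (lam : ℝ) * G i j) (xlo := (Alo i j : ℝ) - lam * G i j) (xhi := (Ahi i j : ℝ) - lam * G i j)
    (m := ((P i j : ℝ) - E i j + s i * s j * d) / (s i * s j)) (M := ((P i j : ℝ) + E i j + s i * s j * d) / (s i * s j))
    (by linarith [hβ.1]) (by linarith [hβ.2]) (by linarith) (by linarith)
    (by rw [div_le_iff₀ hss]; nlinarith [c1r])
    (by rw [div_le_iff₀ hss]; nlinarith [c2r])
    (by rw [div_le_iff₀ hss]; nlinarith [c3r])
    (by rw [div_le_iff₀ hss]; nlinarith [c4r])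
    (by rw [le_div_iff₀ hss]; nlinarith [c5r])
    (by rw [le_div_iff₀ hss]; nlinarith [c6r])
    (by rw [le_div_iff₀ hss]; nlinarith [c7r])
    (by rw [le_div_iff₀ hss]; nlinarith [c8r])
  obtain ⟨k1, k2⟩ := key
  rw [div_le_iff₀ hss] at k1
  rw [le_div_iff₀ hss] at k2
  rw [abs_le]
  constructor <;> nlinarith

end Summit.RiemannHypothesis.RiemannHypothesis.Theorems.EvenWinsBeyondArch

end
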